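import Mathlib.NumberTheory.ArithmeticFunction.Liouville
import Mathlib.Algebra.Polynomial.Eval.Defs
import Mathlib.Algebra.Polynomial.Degree.Defs
import Mathlib.Data.Nat.Prime.Basic
import Mathlib.Analysis.SpecialFunctions.Pow.Real
import HarnessLib

/-!
# The Liouville function at polynomial arguments (Teräväinen 2024)

`Literature/NumberTheory/Sieve/LiouvillePolynomialValues.lean` — named facts (D-0014) from
J. Teräväinen, *On the Liouville function at polynomial arguments*, Amer. J. Math. 146 (2024)
1115–1167 = arXiv:2010.07924 [cite key `Teravainen2024`; held as lit key paper:arxiv-2010.07924,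
statements verified on the arXiv text, §2]:

* `teravainen2024_cor_2_1` — Corollary 2.1: for a non-square `P` factoring into linear factors over
  `ℚ`, each sign `v = ±1` is attained by `λ(P(n))` for `≫_P x` integers `n ≤ x`.
* `teravainen2024_thm_2_3` — Theorem 2.3: for `P(x) = ((x+h₁)²+1)⋯((x+h_k)²+1)` with distinct
  integers `hᵢ`, `λ(P(n)) = v` for infinitely many `n`, for either sign (k = 1: `λ(n²+1)` takes
  both signs infinitely often; positive DENSITY of either sign along `n²+1` is OPEN, loc. cit. §3.4
  and Problem 3.1 for `n² + d`).
* `HasPropertyS` — Definition 2.9 (property S: `P(n)` is `n`-smooth for lower density `≥ η₀/q`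
  along every progression `n ≡ b (mod q)`), and `teravainen2024_prop_2_11_quadratic` —
  Proposition 2.11, quadratic clause: every quadratic `P` with positive leading coefficient has
  property S ("follows with minor modifications from a result of Harman [Arch. Math. 90 (2008)
  239–245] (which improved work of Dartyge [Acta Math. Hungar. 72 (1996) 1–34]) that `n²+1` takes
  `n^{4/5+ε}`-smooth values with positive lower density", loc. cit. before Prop. 2.11 and §7).

## What the source prints (arXiv:2010.07924 §§1–2)

* Def 1.1: "`P(x) ∈ ℤ[x]` is non-square if `P(x)` has positive leading coefficient and `P(x)` is not
  of the form `cQ(x)²` for any integer `c` and polynomial `Q(x) ∈ ℤ[x]`." `λ` is extended "as an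
  even function to `n < 0`, with `λ(0) := 1`".
* Cor 2.1: "Let `P(x)` be a non-square polynomial, and suppose that `P(x)` factors into linear
  factors over `ℚ`. Then for either `v ∈ {−1,+1}` we have `λ(P(n)) = v` for infinitely many `n`.
  Moreover, the number of such `n ≤ x` is `≫_P x`."
* Thm 2.3: "Let `k ≥ 1` and let `P(x) = ((x+h₁)²+1)((x+h₂)²+1)⋯((x+h_k)²+1)` with `h₁, …, h_k`
  distinct integers. Then for either `v ∈ {−1,+1}` we have `λ(P(n)) = v` for infinitely many `n`."
* Def 2.9: "`P(x) ∈ ℤ[x]` with positive leading coefficient has property S if there exists a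
  constant `η₀ > 0` such that for all `q, b ≥ 1` we have
  `liminf_{x→∞} (1/x)|{n ≤ x, n ≡ b (mod q) : P(n) is n-smooth}| ≥ η₀/q`."
* Prop 2.11: "Let `P(x) ∈ ℤ[x]` be a non-constant polynomial with positive leading coefficient. If
  `P` is either quadratic or `P` factors into linear factors over `ℚ`, then `P` has property S."

## Lean rendering

* `λ(m)` for `m ∈ ℤ` is `ArithmeticFunction.liouville m.natAbs` (even extension). Mathlib's
  arithmetic functions vanish at `0`, so `λ(0) = 0` here instead of the paper's convention
  `λ(0) := 1`; this affects only the finitely many `n` with `P(n) = 0` and is immaterial for the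
  "infinitely many" / "`≫ x`" conclusions (documented deviation). In Thm 2.3 every factor
  `(n+hᵢ)²+1 ≥ 1`, so no zero value occurs.
* "factors into linear factors over `ℚ`": `P.map (Int.castRingHom ℚ) = C c * ∏ᵢ (X − C rᵢ)`
  for some `c ∈ ℚ` and rational roots `rᵢ` (explicit, API-light form of `Polynomial.Splits`).
* "`≫_P x`" / positive lower density: `∃ c > 0, ∃ x₀, ∀ x ≥ x₀, c·x ≤ #{n ∈ [1,x] : …}`.
* `liminf ≥ η₀/q` (Def 2.9) is rendered ε-free and equivalently as
  `∀ η < η₀/q, ∃ x₀, ∀ x ≥ x₀, η·x ≤ #{…}`; "`P(n)` is `n`-smooth" as "every prime `p ∣ P(n)` has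
  `p ≤ n`" (divisibility in `ℤ`; a value `P(n) = 0` is then never smooth — again finitely many `n`).

## Use (grounding)

Grounds route `Parity/BatemanHorn/ParityCode`: `teravainen2024_prop_2_11_quadratic` with
`P = X² + 1`, `q = b = 1` gives `Summit.Parity.BatemanHorn.Theses.ParityCode.SmoothValuesDensity`
(there: all `p ∣ n²+1` have `p ≤ 2X`; here the stronger `p ≤ n ≤ X`) — item WEAKER than print, so
item = fact ∘ specialisation; `teravainen2024_thm_2_3` (k = 1) and `teravainen2024_cor_2_1` record
the printed state of the art below / beside the open target `…ParityCode.PosDensPlus` (positive lower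
density of `λ(n²+1) = +1`, open: loc. cit. §3.4).

## What is NOT here

Thm 2.2 (reducible cubics, `≫ √x`), Thm 2.6 (99% Elliott), Cor 2.7, Thm 2.10 (pretentious `g`,
`limsup |mean| ≤ 1 − δ`), Thm 2.12–2.13 (almost all polynomials); the linear-factor clause of
Prop 2.11; Dartyge 1996 / Harman 2008 themselves (`#{n ≤ x : P⁺(n²+1) < x^α} ≫ x` for
`α > 149/179`, resp. `α > 4/5`; paywalled, not held — vendor from the page when acquired);
Borwein–Choi–Ganguli 2013 Thm 2 and Srinivasan 2022 (`λ(n²+d)` changes sign infinitely often,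
Proc. AMS 150). No proofs (named facts).
-/

namespace Literature.NumberTheory.Sieve

open Polynomial
open scoped Classical

/-- The Liouville function at an integer argument, extended evenly (`λ(m) := λ(|m|)`); note
`λ(0) = 0` with Mathlib's `ArithmeticFunction` (the paper sets `λ(0) := 1` — immaterial, see the
module docstring). [cite: Teravainen2024, §1 (conventions before Conjecture 1.2)] -/
def liouvilleInt (m : ℤ) : ℤ := ArithmeticFunction.liouville m.natAbs

/-- **Non-square polynomial** (Teräväinen 2024, Definition 1.1): positive leading coefficient and
not of the form `c·Q(x)²` with `c ∈ ℤ`, `Q ∈ ℤ[x]`. [cite: Teravainen2024, Definition 1.1] -/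
def IsNonSquarePoly (P : Polynomial ℤ) : Prop :=
  0 < P.leadingCoeff ∧ ¬ ∃ (c : ℤ) (Q : Polynomial ℤ), P = C c * Q ^ 2

/-- "`P` factors into linear factors over `ℚ`": over `ℚ`, `P` is a constant times a product of monic
linear factors (explicit form of splitting). [cite: Teravainen2024, Corollary 2.1 (hypothesis)] -/
def FactorsIntoLinearFactorsOverRat (P : Polynomial ℤ) : Prop :=
  ∃ (m : ℕ) (c : ℚ) (r : Fin m → ℚ), P.map (Int.castRingHom ℚ) = C c * ∏ i, (X - C (r i))

/-- **Teräväinen 2024, Corollary 2.1** (Liouville at polynomials factoring over `ℚ`; named fact, as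
printed): for a non-square `P ∈ ℤ[x]` factoring into linear factors over `ℚ` and either sign
`v ∈ {−1, +1}`, `λ(P(n)) = v` for infinitely many `n`, and indeed for `≫_P x` integers `n ≤ x`
(positive lower density of each sign). Users take `(h : teravainen2024_cor_2_1)`.
[cite: Teravainen2024, Corollary 2.1] -/
def teravainen2024_cor_2_1 : Prop :=
  ∀ P : Polynomial ℤ, IsNonSquarePoly P → FactorsIntoLinearFactorsOverRat P →
    ∀ v : ℤ, (v = 1 ∨ v = -1) →
      ∃ c : ℝ, 0 < c ∧ ∃ x₀ : ℕ, ∀ x : ℕ, x₀ ≤ x →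
        c * (x : ℝ) ≤ (((Finset.Icc 1 x).filter (fun n : ℕ => liouvilleInt (P.eval (n : ℤ)) = v)).card : ℝ)

/-- **Teräväinen 2024, Theorem 2.3** (Liouville at products of quadratic factors; named fact, as
printed): for `k ≥ 1` and DISTINCT integers `h₁, …, h_k`, with
`P(x) = ((x+h₁)²+1)⋯((x+h_k)²+1)`, for either `v ∈ {−1,+1}` one has `λ(P(n)) = v` for infinitely
many natural numbers `n` (rendered: beyond every `N` there is such an `n`). For `k = 1` this is
"`λ(n²+1)` takes each sign infinitely often"; positive density of either sign is open (§3.4).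
Users take `(h : teravainen2024_thm_2_3)`. [cite: Teravainen2024, Theorem 2.3] -/
def teravainen2024_thm_2_3 : Prop :=
  ∀ (k : ℕ), 1 ≤ k → ∀ h : Fin k → ℤ, Function.Injective h →
    ∀ v : ℤ, (v = 1 ∨ v = -1) →
      ∀ N : ℕ, ∃ n : ℕ, N ≤ n ∧ liouvilleInt (∏ i, (((n : ℤ) + h i) ^ 2 + 1)) = v

/-- **Property S** (Teräväinen 2024, Definition 2.9): `P ∈ ℤ[x]` (with positive leading
coefficient) has property S if there is `η₀ > 0` such that for all `q, b ≥ 1`,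
`liminf_{x→∞} (1/x)·#{n ≤ x, n ≡ b (mod q) : P(n) is n-smooth} ≥ η₀/q`. Rendered ε-free
(`∀ η < η₀/q`, eventually `η·x ≤ #{…}`), with "`P(n)` is `n`-smooth" as "every prime dividing
`P(n)` is `≤ n`". [cite: Teravainen2024, Definition 2.9] -/
def HasPropertyS (P : Polynomial ℤ) : Prop :=
  ∃ η₀ : ℝ, 0 < η₀ ∧ ∀ q b : ℕ, 1 ≤ q → 1 ≤ b → ∀ η : ℝ, η < η₀ / q →
    ∃ x₀ : ℕ, ∀ x : ℕ, x₀ ≤ x →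
      η * (x : ℝ) ≤ (((Finset.Icc 1 x).filter (fun n : ℕ =>
        n % q = b % q ∧ ∀ p : ℕ, p.Prime → (p : ℤ) ∣ P.eval (n : ℤ) → p ≤ n)).card : ℝ)

/-- **Teräväinen 2024, Proposition 2.11, quadratic clause** (smooth values of quadratic
polynomials; named fact, as printed for "P quadratic"): every `P ∈ ℤ[x]` of degree `2` with
positive leading coefficient has property S. (Printed: "If `P` is either quadratic or `P` factors
into linear factors over `ℚ`, then `P` has property S"; the proof sketch, §7, reduces quadratics to
`n² − Δ` in a progression and invokes Harman 2008 / Dartyge 1996 for `n²+1`-type sequences.)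
With `P = X² + 1`, `q = b = 1` it yields positive lower density of `n ≤ x` all of whose prime
factors of `n²+1` are `≤ n` — grounding `Summit.Parity.BatemanHorn.Theses.ParityCode.SmoothValuesDensity`
(which only asks `≤ 2x`). Users take `(h : teravainen2024_prop_2_11_quadratic)`.
[cite: Teravainen2024, Proposition 2.11 (quadratic case) and §7 proof sketch] -/
def teravainen2024_prop_2_11_quadratic : Prop :=
  ∀ P : Polynomial ℤ, P.natDegree = 2 → 0 < P.leadingCoeff → HasPropertyS P

end Literature.NumberTheory.Sieve
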